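import Mathlib.LinearAlgebra.Matrix.Trace
import Mathlib.Data.Real.Basic
import Mathlib.Tactic.Linarith

/-!
# AssembledJetChartCovariance — the (R33-3) letter certificate: assembled one-loop jets are blind to a
# background-dependent unimodular re-charting of the fluctuation

HONEST FRAMING (cell charter, verbatim): «discharging BetaPertH makes Balaban's UV stability UNCONDITIONAL — a real
constructive-QFT result; it is NOT the continuum limit and NOT the Clay problem.»  This file is a CELL CERTIFICATE
(pub-balaban β sub-cell, lane an2, RULING (R33) of the β lead, journal `CLAIMS.log` l.891): a finite-dimensional,
kernel-checked identity.  It is NOT a statement of Bałaban's papers, carries no `[cite:]` tag, and is therefore NOT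
proposed under `lean/Literature/**`; per RULING (R34-A) of the β lead (journal l.1423) its place is the registered cell
topic `Summits/QuantumFields/BalabanUV/Beta/AssembledJetChartCovariance.lean`, filed VERBATIM by a courier seat (planner-role
seats cannot write there).  Nothing here is `BetaPertH`, a continuum limit, or summit progress.

## What is certified

Let `H(B)` be a family of (bordered) Hessians depending on a background `B`, `K = H(0)⁻¹` (two-sided: `K·H = H·K = 1`),
with first jets `S_b = ∂_b H`, second jets `W_{bc} = ∂_b∂_c H` at `B = 0`.  A background-dependent RE-CHARTING of the
fluctuation variable replaces the family by `H̃(B) = L(B)·H(B)·R(B)` with `L(0) = R(0) = 1` (the constant transport /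
sign part of a lattice reflection is split off, see `jet₁_transport` / `jet₂_transport`).  Writing `Lb, Lc, L2` and
`Ab, Ac, A2` for the first / first / mixed-second jets of `L` and `R`, the product rule gives the transformed jets

* `S̃_b = S_b + Lb·H + H·Ab`                                              (`S₁'`),
* `W̃_{bc} = W_{bc} + Lb·S_c + S_c·Ab + Lc·S_b + S_b·Ac + Lb·H·Ac + Lc·H·Ab + L2·H + H·A2`   (`W₂'`, nine terms).

The ASSEMBLED jets — the ones the one-loop `log det` (and the cell's `ExpKernelCalculus.hessKer = ½·tadpole − ½·bubble`)
actually reads — are `J₁(b) = tr(K·S_b)` and `J₂(b,c) = tr(K·W_{bc}) − tr(K·S_b·K·S_c)`.  THEOREMS (no hypothesis on the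
jets at all, only `K·H = H·K = 1`):

* `jet₁_defect`:  `J̃₁ − J₁ = tr Lb + tr Ab`;
* `jet₂_defect`:  `J̃₂ − J₂ = (tr L2 − tr(Lb·Lc)) + (tr A2 − tr(Ab·Ac))`,

i.e. the defects are exactly the `(b)`- and `(b,c)`-jets of `log det L + log det R` (Jacobi).  Hence (corollaries):
`jet₂_invariant_of_unimodular` (defect hypothesis = unimodularity at second order), `jet₂_similarity` (`L = R⁻¹`:
invariance with NO hypothesis), `jet₂_congruence_orthogonal` (`L = Rᵀ`, `R` orthogonal: `Abᵀ = −Ab`, `Acᵀ = −Ac`,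
`A2ᵀ + A2 + Abᵀ·Ac + Acᵀ·Ab = 0`), and the first-order twins.  Every "contact" contribution (`Lb·H`, `H·Ab`, `Lb·S_c`, …)
cancels between the tadpole and the bubble INSIDE the assembled jet; piece by piece (`S̃ ≠ S`, `W̃ ≠ W`) nothing is
covariant — which is an5's finding X-an5-18 — while the assembled kernel is, which is the β lead's reading (R33-2).

## Dictionary to the cell (documentation only; the typed carriers live in the `Beta/` leaves)

Product chart `U_b = e^{W_b}·e^{B_b}` (fluctuation LEFT, (R25-2)).  A bond-reversing reflection `θ` sends the link
variable to its inverse: `(e^{W}e^{B})⁻¹ = e^{−Ad(e^{−B})W}·e^{−B}` EXACTLY, so the reflected configuration has background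
`−B` (transported) and fluctuation `W^θ = −Ad(e^{−B_b})·W_b` on every reversed bond: `R(B) = P ∘ D(B)` with `P` the
constant signed transport and `D(B) = ⊕_b Ad(e^{−B_b})` (reversed bonds; identity elsewhere) — bond-diagonal,
Killing-orthogonal, determinant one.  Its jets: `Ab = −ad(·)` frozen AT the reversed bond `b` (a finite-rank CONTACT
operator), `A2_{bc} = 0` for `b ≠ c`, `½·ad²` for `b = c`.  On the bordered (KKT) fibre `field ⊕ multiplier` the
multiplier leg of a REVERSED COARSE bond `(μ, y)`, `μ = α`, is re-charted the same way through the averaged background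
(`Ū ↦ Ū⁻¹`): `R_full(B) = diag(P∘D(B), P′∘D′(B̄))`, `D′` again bond-diagonal, orthogonal, unimodular, with jet
`a′_b = −ad(q¹_{(μ,y)}(b))` on the multiplier legs with `μ = α`.  Hence the V–H (field–multiplier) block of the
first-order contact term `A_bᵀ𝕄₀ + 𝕄₀A_b` is `Q₀·a_b + a′_bᵀ·Q₀`: the term `q¹(f)·[f = b ∧ b ∥ α]` (one field leg
frozen AT the reversed derivative bond) plus the rank-one term `[μ = α]·q¹(b)·q¹(f)` — term by term the two summands of
an5's contact family `RootedKernelReflection.ctE` (v1.1, `TKer_vhKerAt : 𝒯_α m = m − E_α`).  With `L = Rᵀ = R⁻¹` both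
`jet₂_similarity` and `jet₂_congruence_orthogonal` apply: the assembled centred kernel is reflection-covariant (the
lead's `hR_of_cov_conj` mechanism), the piecewise stencils are not.

All declarations are `[folklore]` (matrix calculus); axioms ⊆ {propext, Classical.choice, Quot.sound}.

Provenance: b2b-balaban β sub-cell, lane an2 gen 11, 2026-08-19 — v1.0 (journal l.1269), v1.1 (docstring dictionary corrected,
l.1307), v1.2 (this file: namespace `Summit.QuantumFields.BalabanUV.Beta.…` per (R34-A), placement sentence; every declaration
byte-identical to v1.0/v1.1).
-/

namespace Summit.QuantumFields.BalabanUV.Beta.AssembledJetChartCovariance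

open Matrix

variable {n : Type*} [Fintype n] [DecidableEq n]

/-- [folklore] The ASSEMBLED one-jet `J₁ = tr(K·S)` (first background derivative of `log det H`, Jacobi). -/
def J₁ (K S : Matrix n n ℝ) : ℝ := (K * S).trace

/-- [folklore] The ASSEMBLED two-jet `J₂ = tr(K·W) − tr(K·S_b·K·S_c)` (second background derivative of `log det H`;
`2 ×` the cell's `hessKer = ½·tadpole − ½·bubble` shape). -/
def J₂ (K Sb Sc W : Matrix n n ℝ) : ℝ := (K * W).trace - (K * Sb * K * Sc).trace

/-- [folklore] The transformed FIRST jet of `H̃ = L·H·R` at `L(0) = R(0) = 1`: `S̃_b = S_b + Lb·H + H·Ab`. -/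
def S₁' (H S Lb Ab : Matrix n n ℝ) : Matrix n n ℝ := S + Lb * H + H * Ab

/-- [folklore] The transformed SECOND jet of `H̃ = L·H·R` at `L(0) = R(0) = 1` (nine-term product rule):
`W̃ = W + Lb·Sc + Sc·Ab + Lc·Sb + Sb·Ac + Lb·H·Ac + Lc·H·Ab + L2·H + H·A2`. -/
def W₂' (H Sb Sc W Lb Lc L2 Ab Ac A2 : Matrix n n ℝ) : Matrix n n ℝ :=
  W + Lb * Sc + Sc * Ab + Lc * Sb + Sb * Ac + Lb * H * Ac + Lc * H * Ab + L2 * H + H * A2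

section Defect

variable {H K : Matrix n n ℝ}

/-- [folklore] `tr(K·X·H) = tr X` when `H·K = 1`. -/
theorem trace_K_mul_mul_H (hHK : H * K = 1) (X : Matrix n n ℝ) : (K * X * H).trace = X.trace := by
  rw [Matrix.trace_mul_cycle, hHK, Matrix.one_mul]

/-- [folklore] **FIRST-JET DEFECT LAW**: `J̃₁ = J₁ + (tr Lb + tr Ab)` — the defect is the `b`-jet of
`log det L + log det R`. -/
theorem jet₁_defect (hKH : K * H = 1) (hHK : H * K = 1) (S Lb Ab : Matrix n n ℝ) :
    J₁ K (S₁' H S Lb Ab) = J₁ K S + (Lb.trace + Ab.trace) := by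
  have hKH' : ∀ X : Matrix n n ℝ, K * (H * X) = X := fun X => by
    rw [← Matrix.mul_assoc, hKH, Matrix.one_mul]
  have c1 : (K * (Lb * H)).trace = Lb.trace := by
    rw [← Matrix.mul_assoc, trace_K_mul_mul_H hHK]
  unfold J₁ S₁'
  simp only [Matrix.mul_add, Matrix.trace_add, hKH']
  linarith [c1]

/-- [folklore] **SECOND-JET DEFECT LAW**: `J̃₂ = J₂ + ((tr L2 − tr(Lb·Lc)) + (tr A2 − tr(Ab·Ac)))` — the defect is
the `(b,c)`-jet of `log det L + log det R`; every contact term cancels between tadpole and bubble. -/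
theorem jet₂_defect (hKH : K * H = 1) (hHK : H * K = 1) (Sb Sc W Lb Lc L2 Ab Ac A2 : Matrix n n ℝ) :
    J₂ K (S₁' H Sb Lb Ab) (S₁' H Sc Lc Ac) (W₂' H Sb Sc W Lb Lc L2 Ab Ac A2) =
      J₂ K Sb Sc W + ((L2.trace - (Lb * Lc).trace) + (A2.trace - (Ab * Ac).trace)) := by
  have hKH' : ∀ X : Matrix n n ℝ, K * (H * X) = X := fun X => by
    rw [← Matrix.mul_assoc, hKH, Matrix.one_mul]
  have hHK' : ∀ X : Matrix n n ℝ, H * (K * X) = X := fun X => by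
    rw [← Matrix.mul_assoc, hHK, Matrix.one_mul]
  -- the six cyclic rearrangements
  have c2 : (K * (Sb * (K * (Lc * H)))).trace = (Sb * (K * Lc)).trace := by
    have : K * (Sb * (K * (Lc * H))) = K * (Sb * (K * Lc)) * H := by simp only [Matrix.mul_assoc]
    rw [this, trace_K_mul_mul_H hHK]
  have c2' : (K * (Lc * Sb)).trace = (Sb * (K * Lc)).trace := by
    rw [← Matrix.mul_assoc, Matrix.trace_mul_comm]
  have c5 : (K * (Lb * (Lc * H))).trace = (Lb * Lc).trace := by
    have : K * (Lb * (Lc * H)) = K * (Lb * Lc) * H := by simp only [Matrix.mul_assoc]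
    rw [this, trace_K_mul_mul_H hHK]
  have c7 : (Ab * (K * Sc)).trace = (K * (Sc * Ab)).trace := by
    rw [Matrix.trace_mul_comm, Matrix.mul_assoc]
  have c8 : (Ab * (K * (Lc * H))).trace = (K * (Lc * (H * Ab))).trace := by
    rw [Matrix.trace_mul_comm]; simp only [Matrix.mul_assoc]
  have cL2 : (K * (L2 * H)).trace = L2.trace := by
    rw [← Matrix.mul_assoc, trace_K_mul_mul_H hHK]
  unfold J₂ S₁' W₂'
  simp only [Matrix.mul_add, Matrix.add_mul, Matrix.trace_add, Matrix.mul_assoc, hKH', hHK']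
  linarith [c2, c2', c5, c7, c8, cL2]

/-- [folklore] First jet: invariance under a re-charting that is UNIMODULAR to first order (`tr Lb + tr Ab = 0`). -/
theorem jet₁_invariant_of_unimodular (hKH : K * H = 1) (hHK : H * K = 1) {S Lb Ab : Matrix n n ℝ}
    (h : Lb.trace + Ab.trace = 0) : J₁ K (S₁' H S Lb Ab) = J₁ K S := by
  rw [jet₁_defect hKH hHK, h, add_zero]

/-- [folklore] Second jet: invariance under a re-charting that is UNIMODULAR to second order. -/
theorem jet₂_invariant_of_unimodular (hKH : K * H = 1) (hHK : H * K = 1)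
    {Sb Sc W Lb Lc L2 Ab Ac A2 : Matrix n n ℝ}
    (h : (L2.trace - (Lb * Lc).trace) + (A2.trace - (Ab * Ac).trace) = 0) :
    J₂ K (S₁' H Sb Lb Ab) (S₁' H Sc Lc Ac) (W₂' H Sb Sc W Lb Lc L2 Ab Ac A2) = J₂ K Sb Sc W := by
  rw [jet₂_defect hKH hHK, h, add_zero]

/-- [folklore] **SIMILARITY** `H̃ = R⁻¹·H·R`: jets of `L = R⁻¹` are `Lb = −Ab`, `L2 = −A2 + Ab·Ac + Ac·Ab`; the
assembled first jet is invariant with NO hypothesis on `R`. -/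
theorem jet₁_similarity (hKH : K * H = 1) (hHK : H * K = 1) (S Ab : Matrix n n ℝ) :
    J₁ K (S₁' H S (-Ab) Ab) = J₁ K S :=
  jet₁_invariant_of_unimodular hKH hHK (by rw [Matrix.trace_neg, neg_add_cancel])

/-- [folklore] **SIMILARITY**, second jet: invariant with NO hypothesis on `R`. -/
theorem jet₂_similarity (hKH : K * H = 1) (hHK : H * K = 1) (Sb Sc W Ab Ac A2 : Matrix n n ℝ) :
    J₂ K (S₁' H Sb (-Ab) Ab) (S₁' H Sc (-Ac) Ac)
        (W₂' H Sb Sc W (-Ab) (-Ac) (-A2 + Ab * Ac + Ac * Ab) Ab Ac A2) = J₂ K Sb Sc W := by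
  apply jet₂_invariant_of_unimodular hKH hHK
  have hc : (Ac * Ab).trace = (Ab * Ac).trace := Matrix.trace_mul_comm _ _
  simp only [Matrix.trace_add, Matrix.trace_neg, neg_mul_neg]
  linarith [hc]

/-- [folklore] **CONGRUENCE BY AN ORTHOGONAL RE-CHARTING** `H̃ = Rᵀ·H·R` (the Gaussian change of variables of a
bond-reversing reflection in the product chart): with `R` orthogonal to second order — `Abᵀ = −Ab`, `Acᵀ = −Ac`,
`A2ᵀ + A2 + Abᵀ·Ac + Acᵀ·Ab = 0` — the assembled second jet is invariant.  The lead's `hR_of_cov_conj` mechanism. -/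
theorem jet₂_congruence_orthogonal (hKH : K * H = 1) (hHK : H * K = 1) {Sb Sc W Ab Ac A2 : Matrix n n ℝ}
    (hAb : Abᵀ = -Ab) (hAc : Acᵀ = -Ac) (hrel : A2ᵀ + A2 + Abᵀ * Ac + Acᵀ * Ab = 0) :
    J₂ K (S₁' H Sb Abᵀ Ab) (S₁' H Sc Acᵀ Ac) (W₂' H Sb Sc W Abᵀ Acᵀ A2ᵀ Ab Ac A2) = J₂ K Sb Sc W := by
  apply jet₂_invariant_of_unimodular hKH hHK
  have ht := congrArg Matrix.trace hrel
  have hc : (Ac * Ab).trace = (Ab * Ac).trace := Matrix.trace_mul_comm _ _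
  simp only [hAb, hAc, Matrix.trace_add, Matrix.trace_zero, Matrix.trace_transpose, neg_mul, mul_neg, neg_neg,
    Matrix.trace_neg] at ht ⊢
  linarith [ht, hc]

/-- [folklore] First-jet twin of `jet₂_congruence_orthogonal`. -/
theorem jet₁_congruence_orthogonal (hKH : K * H = 1) (hHK : H * K = 1) {S Ab : Matrix n n ℝ} (hAb : Abᵀ = -Ab) :
    J₁ K (S₁' H S Abᵀ Ab) = J₁ K S :=
  jet₁_invariant_of_unimodular hKH hHK (by rw [hAb, Matrix.trace_neg, neg_add_cancel])

end Defect

section Transport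

/-- [folklore] **CONSTANT TRANSPORT**: a background-INDEPENDENT re-charting `H̃ = E·H·P` (`E`, `P` invertible; for a
reflection: the signed transport of legs) is trivially covariant on the assembled first jet:
`K̃ = P⁻¹·K·E⁻¹`, `S̃ = E·S·P`. -/
theorem jet₁_transport {E E' P P' : Matrix n n ℝ} (hEE : E' * E = 1) (hPP : P * P' = 1) (K S : Matrix n n ℝ) :
    J₁ (P' * K * E') (E * S * P) = J₁ K S := by
  have hE : ∀ X : Matrix n n ℝ, E' * (E * X) = X := fun X => by rw [← Matrix.mul_assoc, hEE, Matrix.one_mul]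
  unfold J₁
  simp only [Matrix.mul_assoc, hE]
  rw [Matrix.trace_mul_comm]
  simp only [Matrix.mul_assoc, hPP, Matrix.mul_one]

/-- [folklore] **CONSTANT TRANSPORT**, second jet: `J₂` is invariant under `K ↦ P⁻¹KE⁻¹`, `S ↦ ESP`, `W ↦ EWP`. -/
theorem jet₂_transport {E E' P P' : Matrix n n ℝ} (hEE : E' * E = 1) (hPP : P * P' = 1)
    (K Sb Sc W : Matrix n n ℝ) :
    J₂ (P' * K * E') (E * Sb * P) (E * Sc * P) (E * W * P) = J₂ K Sb Sc W := by
  have hE : ∀ X : Matrix n n ℝ, E' * (E * X) = X := fun X => by rw [← Matrix.mul_assoc, hEE, Matrix.one_mul]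
  have hP : ∀ X : Matrix n n ℝ, P * (P' * X) = X := fun X => by rw [← Matrix.mul_assoc, hPP, Matrix.one_mul]
  have t1 : (P' * (K * (W * P))).trace = (K * W).trace := by
    rw [Matrix.trace_mul_comm]; simp only [Matrix.mul_assoc, hPP, Matrix.mul_one]
  have t2 : (P' * (K * (Sb * (K * (Sc * P))))).trace = (K * (Sb * (K * Sc))).trace := by
    rw [Matrix.trace_mul_comm]; simp only [Matrix.mul_assoc, hPP, Matrix.mul_one]
  unfold J₂
  simp only [Matrix.mul_assoc, hE, hP]
  rw [t1, t2]

end Transport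

section Sanity

/-- [folklore] Sanity instance (`n = Fin 1`, everything scalar): with `H = K = 1` the second-jet defect of the
re-charting `L2 = A2 = Ab = Ac = Lb = Lc = 1` is `(1 − 1) + (1 − 1) = 0`, and indeed `J̃₂ = J₂`. -/
example : J₂ (1 : Matrix (Fin 1) (Fin 1) ℝ) (S₁' 1 1 1 1) (S₁' 1 1 1 1) (W₂' 1 1 1 1 1 1 1 1 1 1) =
    J₂ (1 : Matrix (Fin 1) (Fin 1) ℝ) 1 1 1 :=
  jet₂_invariant_of_unimodular (Matrix.mul_one 1) (Matrix.mul_one 1) (by simp)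

/-- [folklore] … while PIECE BY PIECE nothing is covariant (an5's X-an5-18 in the toy): already for `n = Fin 1`,
`H = 1`, `Lb = Ab = 1` the transformed first jet `S̃ = S + Lb·H + H·Ab = 3` differs from `S = 1`. -/
theorem piecewise_not_covariant : S₁' (1 : Matrix (Fin 1) (Fin 1) ℝ) 1 1 1 ≠ 1 := by
  intro h
  have h00 := congrFun (congrFun h 0) 0
  simp only [S₁', Matrix.add_apply, Matrix.mul_one, Matrix.one_apply_eq] at h00
  norm_num at h00

end Sanity

end Summit.QuantumFields.BalabanUV.Beta.AssembledJetChartCovariance
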